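import Mathlib.GroupTheory.Perm.Fin
import Mathlib.Data.Fin.SuccPred
import Mathlib.Data.Int.Order.Units
import Literature.Combinatorics.SimpleGraph.LittleEarStructure
import Literature.Combinatorics.SimpleGraph.MatchingMinorLift
import HarnessLib

/-!
# The cross-ratio at a non-cut vertex of a minimal non-Pfaffian bipartite graph

Topic `Combinatorics/SimpleGraph`; theorems only. The heart of the digon-free case of the finish of
Little's theorem (`Little1975_isPfaffianBipartite_iff_not_isMatchingMinor`, `LittleTheorem.lean`),
in the setting of `LittleTheoremReduction.lean`: `G ⊆ Fin (m+1) × Fin (m+1)` contains the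
diagonal, is not Pfaffian, every `G.erase e` and every proper central subgraph is Pfaffian. The
vertex (matched pair) `0` of `D(G, M)` has out-arcs `0 → p₁, 0 → p₂` and in-arcs `u₁ → 0, u₂ → 0`.

* `exists_signing_of_minorZero` — Pfaffian-ness of the central subgraph on the pairs `≠ 0` (the
  "minor at `0`", re-indexed by `Fin.succ`) gives a signing `t` of the cells of `G`, `+1` on the
  diagonal and on row and column `0`, under which **every permutation inside `G` fixing `0` has
  weight `+1`** (`Equiv.Perm.decomposeFin`);
* `weight_eq_of_same_ports` — (α) **two directed circuits through `0` using the same out-arc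
  `0 → p` and the same in-arc `u → 0` have the same `t`-weight**, provided `D − 0` has a directed
  path from `u` back to `p`: the two circuits, together with the decompositions of the closed
  walks "circuit minus `0`, then the return path" (`exists_cyclePerms_of_closedWalk`), form an
  evenly covering family; under the Pólya signing of `G.erase (u', 0)` (`u'` the other
  in-neighbour) all members are positive, so the sign product is `+1`; under `t` it is the product
  of the two weights (`prod_weight_eq_prod_sign`);
* `prod_weights_eq_neg_one` — (β) **the four classes of circuits through `0` have `t`-weights
  multiplying to `-1`**: otherwise re-signing the four cells `(0, pⱼ)`, `(uᵢ, 0)` turns `t` into a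
  Pólya signing of `G`;
* `false_of_paths_avoiding` — (γ) **if some arc `g` of `D − 0` can be avoided by directed paths of
  `D − 0` from each `pⱼ` to each `uᵢ` and by return paths, then contradiction**: the four circuits
  through `0` so obtained and three closed walks form an evenly covering family whose sign product
  is `+1` under the Pólya signing of `G.erase g` and `-1` under `t` by (β).

Consequently (assembled in `LittleTheoremProofs.lean`): if `D − 0` is strongly connected then no arc
of `D − 0` is removable in `D − 0`, which for a digon-free `D` contradicts the arc count
(`MinimallyStrongBound.lean`). This vertex version of Little's / Seymour–Thomassen's parity
arguments is, as far as we know, not in the literature in this form; the ingredients are Little's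
intractable sets (Fischer–Little 2001, §2) and the use of minimality at a vertex
(Seymour–Thomassen 1987, (2)–(3)).

## References

* C. H. C. Little, *A characterization of convertible (0,1)-matrices*, J. Combin. Theory Ser. B
  18 (1975) 187–208, §4. [Little1975]
* I. Fischer, C. H. C. Little, *A characterisation of Pfaffian near bipartite graphs*, J. Combin.
  Theory Ser. B 82 (2001) 175–222, §2. [FischerLittle2001]
* P. D. Seymour, C. Thomassen, *Characterization of even directed graphs*, J. Combin. Theory
  Ser. B 42 (1987) 36–45, §4. [SeymourThomassen1987]
-/

namespace Literature.Combinatorics.SimpleGraph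

open Equiv Finset

variable {m : ℕ} {G : Finset (Fin (m + 1) × Fin (m + 1))}

/-! ### The signing coming from the minor at `0` -/

/-- The minor at the vertex `0` (the pairs `≠ 0`, re-indexed by `Fin.succ`) is a central subgraph
(its complement is the pair `0`, matched by the diagonal cell `(0, 0)`). [folklore] -/
theorem isCentralSubgraph_minorZero (h00 : ((0 : Fin (m + 1)), (0 : Fin (m + 1))) ∈ G) :
    IsCentralSubgraph (Finset.univ.filter fun e : Fin m × Fin m => (e.1.succ, e.2.succ) ∈ G) G := by
  classical
  refine isCentralSubgraph_of_injective (Fin.succEmb m) (Fin.succEmb m) (fun e he => ?_) id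
    (fun i hi => ?_) (fun i hi => ?_) (fun i i' _ _ h => h)
  · simpa [Fin.coe_succEmb] using (Finset.mem_filter.1 he).2
  · have hi0 : i = 0 := by
      simpa [Fin.coe_succEmb, Fin.range_succ] using hi
    rw [hi0]; exact h00
  · simpa using hi

/-- **The signing from the minor at `0`.** If `G ⊇ diagonal` and its minor at `0` is Pfaffian, there
is a signing `t`, equal to `+1` on the diagonal and on the row and the column of `0`, under which
every permutation inside `G` fixing `0` has weight `sign σ * ∏ t = 1`. [folklore] -/
theorem exists_signing_of_minorZero (hdiag : ∀ i, (i, i) ∈ G)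
    (hK : IsPfaffianBipartite (Finset.univ.filter fun e : Fin m × Fin m => (e.1.succ, e.2.succ) ∈ G)) :
    ∃ t : Fin (m + 1) × Fin (m + 1) → ℤˣ, (∀ i, t (i, i) = 1) ∧ (∀ i, t (0, i) = 1) ∧
      (∀ i, t (i, 0) = 1) ∧
      ∀ σ : Perm (Fin (m + 1)), (∀ i, (i, σ i) ∈ G) → σ 0 = 0 →
        Perm.sign σ * ∏ i, t (i, σ i) = 1 := by
  classical
  set K := Finset.univ.filter fun e : Fin m × Fin m => (e.1.succ, e.2.succ) ∈ G with hKdef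
  have hKmem : ∀ e : Fin m × Fin m, e ∈ K ↔ (e.1.succ, e.2.succ) ∈ G := fun e => by simp [hKdef]
  have hKdiag : ∀ i : Fin m, (i, i) ∈ K := fun i => (hKmem _).2 (hdiag _)
  obtain ⟨sK, hpol, h1⟩ := hK.exists_isPolyaSigning_diag hKdiag
  -- the lifted signing
  refine ⟨fun e => if h : e.1 = 0 ∨ e.2 = 0 then 1 else
    sK (e.1.pred (not_or.1 h).1, e.2.pred (not_or.1 h).2), fun i => ?_, fun i => ?_, fun i => ?_,
    fun σ hσ hσ0 => ?_⟩
  · by_cases hi : i = 0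
    · simp [hi]
    · simp only [hi, or_self, ↓reduceDIte]
      obtain ⟨j, rfl⟩ := Fin.exists_succ_eq.2 hi
      simp only [Fin.pred_succ, h1]
  · simp
  · simp
  · -- decompose `σ = decomposeFin.symm (0, σ')`
    set p := (Perm.decomposeFin σ).1 with hp
    set σ' := (Perm.decomposeFin σ).2 with hσ'
    have hdec : σ = Perm.decomposeFin.symm (p, σ') := by
      rw [hp, hσ', Prod.mk.eta, Equiv.symm_apply_apply]
    have h0 : σ 0 = p := by
      conv_lhs => rw [hdec]
      exact Perm.decomposeFin_symm_apply_zero p σ'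
    have hp0 : p = 0 := h0.symm.trans hσ0
    have hsucc : ∀ a, σ a.succ = (σ' a).succ := fun a => by
      conv_lhs => rw [hdec]
      rw [Perm.decomposeFin_symm_apply_succ σ' p a, hp0, Equiv.swap_self, Equiv.refl_apply]
    have hsign : Perm.sign σ = Perm.sign σ' := by
      conv_lhs => rw [hdec]
      rw [Perm.decomposeFin.symm_sign, if_pos hp0, one_mul]
    have hσ'mem : ∀ a, (a, σ' a) ∈ K := fun a => by
      rw [hKmem]
      simpa only [hsucc] using hσ a.succ
    have hprod : (∏ i, (fun e : Fin (m + 1) × Fin (m + 1) => if h : e.1 = 0 ∨ e.2 = 0 then (1 : ℤˣ)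
        else sK (e.1.pred (not_or.1 h).1, e.2.pred (not_or.1 h).2)) (i, σ i)) =
        ∏ a, sK (a, σ' a) := by
      rw [Fin.prod_univ_succ]
      simp only [true_or, ↓reduceDIte, one_mul]
      refine Finset.prod_congr rfl fun a _ => ?_
      simp only [hsucc, Fin.succ_ne_zero, or_self, ↓reduceDIte, Fin.pred_succ]
    rw [hprod, hsign]
    exact hpol σ' hσ'mem

/-! ### Lists: arcs of concatenated walks -/

section Lists

variable {α : Type*}

/-- Arcs of a concatenation of walks glued at a common vertex. [folklore] -/
theorem zip_tail_append_of_getLast_eq (A B : List α) (b : α) (hA : A ≠ []) (h : A.getLast hA = b) :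
    (A ++ B).zip (A ++ B).tail = A.zip A.tail ++ (b :: B).zip B := by
  cases B with
  | nil => simp
  | cons c B' =>
    rw [zip_tail_append A (c :: B') hA (List.cons_ne_nil _ _), h]
    rfl

/-- Counting arcs of a concatenation of walks glued at a common vertex. [folklore] -/
theorem count_zip_tail_append_of_getLast_eq [DecidableEq α] (A B : List α) (b : α) (hA : A ≠ [])
    (h : A.getLast hA = b) (p : α × α) :
    ((A ++ B).zip (A ++ B).tail).count p = (A.zip A.tail).count p + ((b :: B).zip B).count p := by
  rw [zip_tail_append_of_getLast_eq A B b hA h, List.count_append]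

end Lists

/-! ### The path of a directed circuit through `0` -/

/-- **The open path of a circuit through `0`.** For a cyclic permutation `γ` inside `G` with
`γ u = 0`, `u ≠ 0`, the list `(γ.toList 0).tail = [γ 0, …, u]` is a directed path of `D − 0`
(a chain of arcs of `G`, no vertex `0`, no repetition) from `γ 0` to `u`, and for `a ≠ b` the
number of its arcs `(a, b)`, plus one if `(a, b)` is `(u, 0)` or `(0, γ 0)`, is `[γ a = b]`.
[folklore] -/
theorem tail_toList_zero {γ : Perm (Fin (m + 1))} (hγ : γ.IsCycle) (hγmem : ∀ i, (i, γ i) ∈ G)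
    {u : Fin (m + 1)} (hu : u ≠ 0) (hγu : γ u = 0) :
    (γ.toList 0).tail ≠ [] ∧ (γ.toList 0).tail.IsChain (IsArc G) ∧
      (∀ x ∈ (γ.toList 0).tail, x ≠ 0) ∧ (γ.toList 0).tail.head? = some (γ 0) ∧
      (γ.toList 0).tail.getLast? = some u ∧ (γ.toList 0).tail.Nodup ∧
      ∀ a b, a ≠ b → ((γ.toList 0).tail.zip (γ.toList 0).tail.tail).count (a, b) +
        (if (a, b) = (u, 0) then 1 else 0) + (if (a, b) = (0, γ 0) then 1 else 0) =
        if γ a = b then 1 else 0 := by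
  classical
  obtain ⟨h2, hnd, hform, hhead, hlast⟩ := toList_of_apply_eq hγ hu hγu
  have hchain := isChain_toList hγ hγmem hu hγu
  set M := γ.toList 0 with hM
  -- `M = 0 :: γ 0 :: rest`
  obtain ⟨x₀, x₁, rest, hMeq⟩ : ∃ x₀ x₁ rest, M = x₀ :: x₁ :: rest := by
    match M, h2 with
    | x₀ :: x₁ :: rest, _ => exact ⟨x₀, x₁, rest, rfl⟩
  have hx₀ : x₀ = 0 := by
    rw [hMeq] at hhead; simpa using hhead
  have hx₁ : x₁ = γ 0 := by
    have h1 : M[1]'(by omega) = (γ ^ 1) 0 := Perm.getElem_toList γ 0 1 (by rw [← hM]; omega)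
    rw [pow_one] at h1
    simp only [hMeq, List.getElem_cons_succ, List.getElem_cons_zero] at h1
    exact h1
  subst hx₀ hx₁
  have htail : M.tail = γ 0 :: rest := by rw [hMeq]; rfl
  rw [htail]
  rw [hMeq] at hnd hchain hlast
  refine ⟨List.cons_ne_nil _ _, ?_, ?_, rfl, ?_, hnd.of_cons, fun a b hab => ?_⟩
  · exact isChain_isArc_mono (List.IsChain.tail hchain) (Finset.erase_subset _ _)
  · intro x hx h0
    rw [h0] at hx
    exact (List.nodup_cons.1 hnd).1 hx
  · simpa [List.getLast?_cons_cons] using hlast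
  · have hcount := count_zip_tail_toList hγ hu hγu hab
    rw [← hM, hMeq] at hcount
    -- the arcs of `0 :: γ 0 :: rest` are `(0, γ 0)` and those of `γ 0 :: rest`
    have hz : ((0 : Fin (m + 1)) :: γ 0 :: rest).zip (γ 0 :: rest) =
        (0, γ 0) :: (γ 0 :: rest).zip rest := rfl
    simp only [List.tail_cons, hz, List.count_cons, beq_iff_eq] at hcount
    simp only [List.tail_cons]
    rw [← hcount]
    by_cases h : (a, b) = (0, γ 0)
    · rw [if_pos h, if_pos h.symm]; omega
    · rw [if_neg h, if_neg (Ne.symm h)]; omega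

/-! ### (α) Circuits through `0` with the same ports have the same weight -/

/-- Parity bookkeeping. [folklore] -/
private theorem even_of_counts₀ {iA iB cA cB cS δ g₁ g₂ : ℕ} (hA : cA + δ = iA) (hB : cB + δ = iB)
    (h₁ : (cA + cS) % 2 = g₁ % 2) (h₂ : (cB + cS) % 2 = g₂ % 2) :
    Even (g₁ + g₂ + iB + iA) := by
  rw [Nat.even_iff]; omega

/-- **(α) Circuits through `0` using the same out-arc `0 → p` and the same in-arc `u → 0` have the
same weight under the signing `t` of the minor at `0`**, provided `D − 0` has a directed path
from `u` to `p` and `G.erase (u', 0)` is Pfaffian for the other in-neighbour `u'` of `0` (its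
normalised Pólya signing `s` is positive on every circuit not using the cell `(u', 0)`).
[cite: Little1975, §4] -/
theorem weight_eq_of_same_ports (hdiag : ∀ i, (i, i) ∈ G)
    {t : Fin (m + 1) × Fin (m + 1) → ℤˣ} (ht1 : ∀ i, t (i, i) = 1)
    (htpos : ∀ σ : Perm (Fin (m + 1)), σ.IsCycle → (∀ i, (i, σ i) ∈ G) → σ 0 = 0 →
      Perm.sign σ * ∏ i, t (i, σ i) = 1)
    {s : Fin (m + 1) × Fin (m + 1) → ℤˣ} (hs1 : ∀ i, s (i, i) = 1) {u' : Fin (m + 1)} (hu' : u' ≠ 0)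
    (hspos : ∀ σ : Perm (Fin (m + 1)), σ.IsCycle → (∀ i, (i, σ i) ∈ G) → σ u' ≠ 0 →
      Perm.sign σ * ∏ i, s (i, σ i) = 1)
    {γ γ' : Perm (Fin (m + 1))} (hγ : γ.IsCycle) (hγmem : ∀ i, (i, γ i) ∈ G) (hγ' : γ'.IsCycle)
    (hγ'mem : ∀ i, (i, γ' i) ∈ G) {u p : Fin (m + 1)} (hu : u ≠ 0) (hup : u ≠ p) (huu' : u ≠ u')
    (hγu : γ u = 0) (hγ0 : γ 0 = p) (hγ'u : γ' u = 0) (hγ'0 : γ' 0 = p)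
    {lT : List (Fin (m + 1))} (hTchain : (u :: lT).IsChain (IsArc G)) (hT0 : ∀ x ∈ u :: lT, x ≠ 0)
    (hTlast : (u :: lT).getLast (List.cons_ne_nil _ _) = p) :
    Perm.sign γ * ∏ i, t (i, γ i) = Perm.sign γ' * ∏ i, t (i, γ' i) := by
  classical
  -- `lT ≠ []` since the return path goes from `u` to `p ≠ u`
  obtain ⟨t₁, lT', rfl⟩ : ∃ t₁ lT', lT = t₁ :: lT' := by
    cases lT with
    | nil => exact absurd hTlast hup
    | cons t₁ lT' => exact ⟨t₁, lT', rfl⟩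
  have hirr : ∀ x : Fin (m + 1), ¬ IsArc G x x := fun x h => h.1 rfl
  -- the closed walks `(X - 0) · T` for `X = γ, γ'`, decomposed into circuits avoiding `0`
  have hwalk : ∀ X : Perm (Fin (m + 1)), X.IsCycle → (∀ i, (i, X i) ∈ G) → X u = 0 → X 0 = p →
      ∃ Γ : List (Perm (Fin (m + 1))), (∀ σ ∈ Γ, σ.IsCycle ∧ (∀ i, (i, σ i) ∈ G) ∧ σ 0 = 0 ∧
          σ u' ≠ 0) ∧
        ∀ a b, a ≠ b → ((((X.toList 0).tail).zip (X.toList 0).tail.tail).count (a, b) +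
          ((u :: t₁ :: lT').zip (t₁ :: lT')).count (a, b)) % 2 =
            (Γ.countP fun σ => σ a = b) % 2 := by
    intro X hX hXmem hXu hX0
    obtain ⟨hne, hchain, h0, hhead, hlast, -, -⟩ := tail_toList_zero hX hXmem hu hXu
    set P := (X.toList 0).tail with hP
    have hPlast : P.getLast hne = u := by
      rw [List.getLast?_eq_getLast_of_ne_nil hne, Option.some_inj] at hlast; exact hlast
    -- the walk `P ++ t₁ :: lT'`
    have hW2 : 2 ≤ (P ++ t₁ :: lT').length := by
      rw [List.length_append]; have := List.length_pos_iff.2 hne; simp; omega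
    have hWchain : (P ++ t₁ :: lT').IsChain (IsArc G) := by
      refine List.IsChain.append hchain hTchain.tail fun x hx y hy => ?_
      rw [hlast, Option.mem_def, Option.some_inj] at hx
      simp only [List.head?_cons, Option.mem_def, Option.some_inj] at hy
      subst hx; subst hy
      exact (List.isChain_cons_cons.1 hTchain).1
    have hWclosed : (P ++ t₁ :: lT').head? = (P ++ t₁ :: lT').getLast? := by
      have hl : (t₁ :: lT').getLast (List.cons_ne_nil _ _) = p := by
        rw [List.getLast_cons (List.cons_ne_nil _ _)] at hTlast; exact hTlast
      rw [List.head?_append, hhead, hX0, List.getLast?_append,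
        List.getLast?_eq_getLast_of_ne_nil (List.cons_ne_nil _ _), hl]
      rfl
    obtain ⟨Γ, hΓ, hcount⟩ := exists_cyclePerms_of_closedWalk hirr _ hW2 hWchain hWclosed
    have hzip : (P ++ t₁ :: lT').zip (P ++ t₁ :: lT').tail =
        P.zip P.tail ++ (u :: t₁ :: lT').zip (t₁ :: lT') := by
      rw [zip_tail_append _ _ hne (List.cons_ne_nil _ _), hPlast]; rfl
    -- vertices of the walk are `≠ 0`
    have hWne0 : ∀ x ∈ P ++ t₁ :: lT', x ≠ 0 := by
      intro x hx
      rcases List.mem_append.1 hx with hx | hx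
      · exact h0 x hx
      · exact hT0 x (List.mem_cons_of_mem _ hx)
    refine ⟨Γ, fun σ hσ => ?_, fun a b hab => ?_⟩
    · obtain ⟨hσc, hσrel, hσmem⟩ := hΓ σ hσ
      have hin : ∀ i, (i, σ i) ∈ G := fun i => by
        rcases hσrel i with h | h
        · rw [h]; exact hdiag i
        · exact h.2
      have hfix : ∀ a, σ a ≠ a → a ≠ 0 ∧ σ a ≠ 0 := by
        intro a ha
        have hmem := hσmem a ha
        have h12 := List.of_mem_zip hmem
        exact ⟨hWne0 _ h12.1, hWne0 _ (List.mem_of_mem_tail h12.2)⟩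
      refine ⟨hσc, hin, ?_, fun h => ?_⟩
      · by_contra h
        exact (hfix 0 h).1 rfl
      · by_cases hfu : σ u' = u'
        · exact hu' (hfu.symm.trans h)
        · exact (hfix u' hfu).2 h
    · rw [← hcount a b hab, hzip, List.count_append]
  obtain ⟨Γ₁, hΓ₁, hc₁⟩ := hwalk γ hγ hγmem hγu hγ0
  obtain ⟨Γ₂, hΓ₂, hc₂⟩ := hwalk γ' hγ' hγ'mem hγ'u hγ'0
  -- the family
  set F : List (Perm (Fin (m + 1))) := γ :: γ' :: (Γ₁ ++ Γ₂) with hF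
  have hmemF : ∀ σ ∈ F, σ = γ ∨ σ = γ' ∨ σ ∈ Γ₁ ∨ σ ∈ Γ₂ := by
    intro σ hσ
    simp only [hF, List.mem_cons, List.mem_append] at hσ
    tauto
  -- even coverage
  have heven : ∀ a b : Fin (m + 1), a ≠ b → Even (F.countP fun σ => σ a = b) := by
    intro a b hab
    have hA := (tail_toList_zero hγ hγmem hu hγu).2.2.2.2.2.2 a b hab
    have hB := (tail_toList_zero hγ' hγ'mem hu hγ'u).2.2.2.2.2.2 a b hab
    rw [hγ0] at hA; rw [hγ'0] at hB
    rw [add_assoc] at hA hB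
    have h₁ := hc₁ a b hab
    have h₂ := hc₂ a b hab
    simp only [hF, List.countP_cons, List.countP_append, decide_eq_true_eq]
    exact even_of_counts₀ hA hB h₁ h₂
  -- sign product under `s`: all members are positive
  have hsF : (F.map fun σ => Perm.sign σ * ∏ i, s (i, σ i)).prod = 1 := by
    apply List.prod_eq_one
    intro x hx
    obtain ⟨σ, hσ, rfl⟩ := List.mem_map.1 hx
    rcases hmemF σ hσ with h | h | h | h
    · rw [h]; exact hspos _ hγ hγmem (by rw [← hγu]; exact fun h => huu' (γ.injective h).symm)
    · rw [h]; exact hspos _ hγ' hγ'mem (by rw [← hγ'u]; exact fun h => huu' (γ'.injective h).symm)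
    · obtain ⟨hc, hin, -, hu'⟩ := hΓ₁ σ h; exact hspos σ hc hin hu'
    · obtain ⟨hc, hin, -, hu'⟩ := hΓ₂ σ h; exact hspos σ hc hin hu'
  -- sign product under `t`
  have htF : (F.map fun σ => Perm.sign σ * ∏ i, t (i, σ i)).prod =
      (Perm.sign γ * ∏ i, t (i, γ i)) * (Perm.sign γ' * ∏ i, t (i, γ' i)) := by
    have hΓw : ∀ Γ : List (Perm (Fin (m + 1))),
        (∀ σ ∈ Γ, σ.IsCycle ∧ (∀ i, (i, σ i) ∈ G) ∧ σ 0 = 0 ∧ σ u' ≠ 0) →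
        (Γ.map fun σ => Perm.sign σ * ∏ i, t (i, σ i)).prod = 1 := by
      intro Γ hΓ
      apply List.prod_eq_one
      intro x hx
      obtain ⟨σ, hσ, rfl⟩ := List.mem_map.1 hx
      obtain ⟨hc, hin, h0, -⟩ := hΓ σ hσ
      exact htpos σ hc hin h0
    simp only [hF, List.map_cons, List.map_append, List.prod_cons, List.prod_append]
    rw [hΓw Γ₁ hΓ₁, hΓw Γ₂ hΓ₂, mul_one, mul_one]
  have h := prod_weight_eq_prod_sign F heven s hs1
  rw [hsF] at h
  have h' := prod_weight_eq_prod_sign F heven t ht1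
  rw [htF, ← h] at h'
  -- `w * w' = 1` in `ℤˣ` gives `w = w'`
  calc Perm.sign γ * ∏ i, t (i, γ i)
      = (Perm.sign γ * ∏ i, t (i, γ i)) * ((Perm.sign γ' * ∏ i, t (i, γ' i)) *
          (Perm.sign γ' * ∏ i, t (i, γ' i))) := by rw [Int.units_mul_self, mul_one]
    _ = Perm.sign γ' * ∏ i, t (i, γ' i) := by rw [← mul_assoc, h', one_mul]

/-! ### (β) The four classes of circuits through `0` have weights multiplying to `-1` -/

/-- Along a permutation through `u → 0` (`u ≠ 0`), a cell function trivial off row and column `0`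
has product `d (0, σ 0) * d (u, 0)`. [folklore] -/
theorem prod_factor_of_apply_eq_zero (d : Fin (m + 1) × Fin (m + 1) → ℤˣ)
    (hd : ∀ e : Fin (m + 1) × Fin (m + 1), e.1 ≠ 0 → e.2 ≠ 0 → d e = 1) (σ : Perm (Fin (m + 1)))
    {u : Fin (m + 1)} (hu : u ≠ 0) (hσu : σ u = 0) :
    ∏ x, d (x, σ x) = d (0, σ 0) * d (u, 0) := by
  rw [Finset.prod_eq_mul (0 : Fin (m + 1)) u (Ne.symm hu), hσu]
  · intro c _ hc
    exact hd _ hc.1 fun h => hc.2 (σ.injective (h.trans hσu.symm))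
  · intro h; exact absurd (Finset.mem_univ _) h
  · intro h; exact absurd (Finset.mem_univ _) h

/-- Along a permutation fixing `0`, a cell function trivial off row and column `0` and at `(0, 0)`
has product `1`. [folklore] -/
theorem prod_factor_of_apply_zero (d : Fin (m + 1) × Fin (m + 1) → ℤˣ)
    (hd : ∀ e : Fin (m + 1) × Fin (m + 1), e.1 ≠ 0 → e.2 ≠ 0 → d e = 1) (hd0 : d (0, 0) = 1)
    (σ : Perm (Fin (m + 1))) (h0 : σ 0 = 0) : ∏ x, d (x, σ x) = 1 := by
  refine Finset.prod_eq_one fun x _ => ?_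
  by_cases hx : x = 0
  · rw [hx, h0, hd0]
  · exact hd _ hx fun h => hx (σ.injective (h.trans h0.symm))

/-- **(β) The cross-ratio at `0` is odd.** Let `G ⊇ diagonal` be non-Pfaffian, `0 → p₁, 0 → p₂`
the out-arcs and `u₁ → 0, u₂ → 0` the in-arcs of `0`, `t` the signing of the minor at `0`
(`exists_signing_of_minorZero`), and suppose (α): circuits through `0` with the same ports have
the same `t`-weight. Then for any four circuits `Cⱼᵢ` through `0 → pⱼ` and `uᵢ → 0` the product of
the four `t`-weights is `-1` — otherwise re-signing the four cells at `0` gives a Pólya signing of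
`G`. [cite: Little1975, §4] -/
theorem prod_weights_eq_neg_one (hdiag : ∀ i, (i, i) ∈ G) (hG : ¬ IsPfaffianBipartite G)
    {t : Fin (m + 1) × Fin (m + 1) → ℤˣ} (ht1 : ∀ i, t (i, i) = 1)
    (htpos : ∀ σ : Perm (Fin (m + 1)), σ.IsCycle → (∀ i, (i, σ i) ∈ G) → σ 0 = 0 →
      Perm.sign σ * ∏ i, t (i, σ i) = 1)
    {p₁ p₂ u₁ u₂ : Fin (m + 1)} (hp : ∀ c, IsArc G 0 c ↔ c = p₁ ∨ c = p₂)
    (hu : ∀ c, IsArc G c 0 ↔ c = u₁ ∨ c = u₂) (hp12 : p₁ ≠ p₂) (hu12 : u₁ ≠ u₂)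
    (hclass : ∀ γ γ' : Perm (Fin (m + 1)), γ.IsCycle → (∀ i, (i, γ i) ∈ G) → γ'.IsCycle →
      (∀ i, (i, γ' i) ∈ G) → γ 0 ≠ 0 → γ 0 = γ' 0 → γ.symm 0 = γ'.symm 0 →
      Perm.sign γ * ∏ i, t (i, γ i) = Perm.sign γ' * ∏ i, t (i, γ' i))
    {C₁₁ C₁₂ C₂₁ C₂₂ : Perm (Fin (m + 1))}
    (h₁₁ : C₁₁.IsCycle ∧ (∀ x, (x, C₁₁ x) ∈ G) ∧ C₁₁ 0 = p₁ ∧ C₁₁ u₁ = 0)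
    (h₁₂ : C₁₂.IsCycle ∧ (∀ x, (x, C₁₂ x) ∈ G) ∧ C₁₂ 0 = p₁ ∧ C₁₂ u₂ = 0)
    (h₂₁ : C₂₁.IsCycle ∧ (∀ x, (x, C₂₁ x) ∈ G) ∧ C₂₁ 0 = p₂ ∧ C₂₁ u₁ = 0)
    (h₂₂ : C₂₂.IsCycle ∧ (∀ x, (x, C₂₂ x) ∈ G) ∧ C₂₂ 0 = p₂ ∧ C₂₂ u₂ = 0) :
    (Perm.sign C₁₁ * ∏ x, t (x, C₁₁ x)) * (Perm.sign C₁₂ * ∏ x, t (x, C₁₂ x)) *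
      (Perm.sign C₂₁ * ∏ x, t (x, C₂₁ x)) * (Perm.sign C₂₂ * ∏ x, t (x, C₂₂ x)) = -1 := by
  classical
  -- the ports are vertices `≠ 0`
  have hp₁ : p₁ ≠ 0 := fun h => ((hp p₁).2 (Or.inl rfl)).1 h.symm
  have hp₂ : p₂ ≠ 0 := fun h => ((hp p₂).2 (Or.inr rfl)).1 h.symm
  have hu₁ : u₁ ≠ 0 := fun h => ((hu u₁).2 (Or.inl rfl)).1 h
  have hu₂ : u₂ ≠ 0 := fun h => ((hu u₂).2 (Or.inr rfl)).1 h
  set w₁₁ : ℤˣ := Perm.sign C₁₁ * ∏ x, t (x, C₁₁ x) with hw₁₁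
  set w₁₂ : ℤˣ := Perm.sign C₁₂ * ∏ x, t (x, C₁₂ x) with hw₁₂
  set w₂₁ : ℤˣ := Perm.sign C₂₁ * ∏ x, t (x, C₂₁ x) with hw₂₁
  set w₂₂ : ℤˣ := Perm.sign C₂₂ * ∏ x, t (x, C₂₂ x) with hw₂₂
  by_contra hne
  have hone : w₁₁ * w₁₂ * w₂₁ * w₂₂ = 1 := (Int.units_eq_one_or _).resolve_right hne
  -- the re-signing factors
  set α₂ : ℤˣ := w₂₁ * w₁₁ with hα₂
  set d : Fin (m + 1) × Fin (m + 1) → ℤˣ := fun e => if e = (0, p₁) then 1 else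
    if e = (0, p₂) then α₂ else if e = (u₁, 0) then w₁₁ else if e = (u₂, 0) then w₁₂ else 1 with hd
  have hdoff : ∀ e : Fin (m + 1) × Fin (m + 1), e.1 ≠ 0 → e.2 ≠ 0 → d e = 1 := by
    intro e h1 h2
    simp only [hd]
    rw [if_neg (fun h => h1 (Prod.ext_iff.1 h).1), if_neg (fun h => h1 (Prod.ext_iff.1 h).1),
      if_neg (fun h => h2 (Prod.ext_iff.1 h).2), if_neg (fun h => h2 (Prod.ext_iff.1 h).2)]
  have hd00 : d (0, 0) = 1 := by
    simp only [hd]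
    rw [if_neg (fun h => hp₁ (Prod.ext_iff.1 h).2.symm), if_neg (fun h => hp₂ (Prod.ext_iff.1 h).2.symm),
      if_neg (fun h => hu₁ (Prod.ext_iff.1 h).1.symm), if_neg (fun h => hu₂ (Prod.ext_iff.1 h).1.symm)]
  have hdp₁ : d (0, p₁) = 1 := by simp [hd]
  have hdp₂ : d (0, p₂) = α₂ := by simp [hd, hp12.symm]
  have hdu₁ : d (u₁, 0) = w₁₁ := by simp [hd, hu₁]
  have hdu₂ : d (u₂, 0) = w₁₂ := by simp [hd, hu₂, hu12.symm]
  apply hG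
  rw [isPfaffianBipartite_iff_forall_isCycle hdiag]
  refine ⟨fun e => d e * t e, fun i => ?_, fun γ hγ hγmem => ?_⟩
  · show d (i, i) * t (i, i) = 1
    by_cases hi : i = 0
    · rw [hi, hd00, ht1, one_mul]
    · rw [hdoff _ hi hi, ht1, one_mul]
  show Perm.sign γ * ∏ x, d (x, γ x) * t (x, γ x) = 1
  rw [Finset.prod_mul_distrib, mul_left_comm]
  by_cases h0 : γ 0 = 0
  · rw [prod_factor_of_apply_zero d hdoff hd00 γ h0, one_mul]
    exact htpos γ hγ hγmem h0
  · -- the ports of `γ`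
    have hout : γ 0 = p₁ ∨ γ 0 = p₂ := (hp _).1 ⟨Ne.symm h0, hγmem 0⟩
    set u := γ.symm 0 with hudef
    have hγu : γ u = 0 := by rw [hudef, Equiv.apply_symm_apply]
    have hu0 : u ≠ 0 := fun h => h0 (by rw [h] at hγu; exact hγu)
    have hin : u = u₁ ∨ u = u₂ := (hu _).1 ⟨hu0, by simpa only [hγu] using hγmem u⟩
    rw [prod_factor_of_apply_eq_zero d hdoff γ hu0 hγu]
    -- compare with the representative circuit with the same ports
    have key : ∀ (C : Perm (Fin (m + 1))) (p u' : Fin (m + 1)),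
        C.IsCycle ∧ (∀ x, (x, C x) ∈ G) ∧ C 0 = p ∧ C u' = 0 → γ 0 = p → u = u' →
        Perm.sign γ * ∏ x, t (x, γ x) = Perm.sign C * ∏ x, t (x, C x) := by
      rintro C p u' ⟨hCc, hCmem, hC0, hCu⟩ hγ0 huu'
      refine hclass γ C hγ hγmem hCc hCmem h0 (hγ0.trans hC0.symm) ?_
      rw [← hudef, huu', Equiv.eq_symm_apply, hCu]
    rcases hout with hγ0 | hγ0 <;> rcases hin with huu | huu
    · rw [hγ0, huu, hdp₁, hdu₁, key C₁₁ p₁ u₁ h₁₁ hγ0 huu, ← hw₁₁, one_mul, Int.units_mul_self]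
    · rw [hγ0, huu, hdp₁, hdu₂, key C₁₂ p₁ u₂ h₁₂ hγ0 huu, ← hw₁₂, one_mul, Int.units_mul_self]
    · rw [hγ0, huu, hdp₂, hdu₁, key C₂₁ p₂ u₁ h₂₁ hγ0 huu, ← hw₂₁, hα₂]
      calc w₂₁ * w₁₁ * w₁₁ * w₂₁ = w₂₁ * (w₁₁ * w₁₁) * w₂₁ := by rw [mul_assoc w₂₁]
        _ = 1 := by rw [Int.units_mul_self, mul_one, Int.units_mul_self]
    · rw [hγ0, huu, hdp₂, hdu₂, key C₂₂ p₂ u₂ h₂₂ hγ0 huu, ← hw₂₂, hα₂]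
      rw [mul_comm w₂₁ w₁₁, mul_right_comm w₁₁ w₂₁ w₁₂]
      exact hone

/-! ### (γ) A removable arc of `D − 0` gives a contradiction -/

/-- Counting arcs of a concatenation of walks glued at a common vertex (`getLast?` form).
[folklore] -/
theorem count_zip_tail_append_of_getLast? {α : Type*} [DecidableEq α] (A B : List α) (b : α)
    (h : A.getLast? = some b) (p : α × α) :
    ((A ++ B).zip (A ++ B).tail).count p = (A.zip A.tail).count p + ((b :: B).zip B).count p := by
  have hA : A ≠ [] := by rintro rfl; simp at h
  rw [List.getLast?_eq_getLast_of_ne_nil hA, Option.some_inj] at h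
  exact count_zip_tail_append_of_getLast_eq A B b hA h p

/-- **The circuit through `0` closing a path of `D − 0`.** Let `P = [p, …, u]` be a directed path of
`D − 0` avoiding the cell `g` (a chain of arcs of `G.erase g`, no repeated vertex, no vertex `0`)
with `0 → p` and `u → 0` arcs of `G`, and `g` off the diagonal, row `0` and column `0`. Then
`(0 :: P).formPerm` is a directed circuit inside `G` avoiding the cell `g`, through `0 → p` and
`u → 0`, whose cells `(a, b)`, `a ≠ b`, are counted by the arcs of `P` plus `(0, p)` and `(u, 0)`.
[folklore] -/
theorem circuit_of_path (hdiag : ∀ i, (i, i) ∈ G) {g : Fin (m + 1) × Fin (m + 1)} (hg : g.1 ≠ g.2)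
    (hg1 : g.1 ≠ 0)
    (hg2 : g.2 ≠ 0) {P : List (Fin (m + 1))} (hPchain : P.IsChain (IsArc (G.erase g)))
    (hPnd : P.Nodup) (hP0 : ∀ x ∈ P, x ≠ 0) {p u : Fin (m + 1)} (hPhead : P.head? = some p)
    (hPlast : P.getLast? = some u) (hp : IsArc G 0 p) (hu : IsArc G u 0) :
    ((0 :: P).formPerm).IsCycle ∧ (∀ x, (x, (0 :: P).formPerm x) ∈ G) ∧
      (∀ x, (x, (0 :: P).formPerm x) ≠ g) ∧ (0 :: P).formPerm 0 = p ∧ (0 :: P).formPerm u = 0 ∧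
      ∀ a b, a ≠ b → (P.zip P.tail).count (a, b) + (if (u, 0) = (a, b) then 1 else 0) +
        (if ((0 : Fin (m + 1)), p) = (a, b) then 1 else 0) =
          if (0 :: P).formPerm a = b then 1 else 0 := by
  classical
  have hPne : P ≠ [] := by rintro rfl; simp at hPhead
  obtain ⟨p', rest, rfl⟩ := List.exists_cons_of_ne_nil hPne
  have hpp : p' = p := by simpa using hPhead
  subst hpp
  set L : List (Fin (m + 1)) := 0 :: p' :: rest with hL
  have hLnd : L.Nodup := List.nodup_cons.2 ⟨fun h => hP0 0 h rfl, hPnd⟩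
  have hL2 : 2 ≤ L.length := by simp [hL]
  have hLlast : L.getLast (List.cons_ne_nil _ _) = u := by
    show ((0 : Fin (m + 1)) :: p' :: rest).getLast (List.cons_ne_nil _ _) = u
    rw [List.getLast_cons (List.cons_ne_nil _ _)]
    rw [List.getLast?_eq_getLast_of_ne_nil (List.cons_ne_nil _ _), Option.some_inj] at hPlast
    exact hPlast
  -- the closed chain `0 :: P ++ [0]`
  have htake : L ++ L.take 1 = L ++ [0] := by simp [hL]
  have hclosed : (L ++ L.take 1).IsChain (IsArc G) := by
    rw [htake]
    refine List.IsChain.append ?_ (List.isChain_singleton _) fun x hx y hy => ?_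
    · exact List.IsChain.cons_cons hp (isChain_isArc_mono hPchain (Finset.erase_subset _ _))
    · rw [List.getLast?_eq_getLast_of_ne_nil (List.cons_ne_nil _ _), hLlast, Option.mem_def,
        Option.some_inj] at hx
      simp only [List.head?_cons, Option.mem_def, Option.some_inj] at hy
      subst hx; subst hy; exact hu
  have hcyc : (L.formPerm).IsCycle := List.isCycle_formPerm hLnd hL2
  have hrel : ∀ a, L.formPerm a = a ∨ IsArc G a (L.formPerm a) :=
    formPerm_apply_rel_of_isChain L hLnd hL2 hclosed
  -- the arcs of the closed list
  have hzipL : (L ++ L.take 1).zip (L ++ L.take 1).tail =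
      (0, p') :: ((p' :: rest).zip rest ++ [(u, 0)]) := by
    rw [htake, zip_tail_append L [0] (List.cons_ne_nil _ _) (List.cons_ne_nil _ _), hLlast]
    rfl
  refine ⟨hcyc, fun x => ?_, fun x hx => ?_, ?_, ?_, fun a b hab => ?_⟩
  · rcases hrel x with h | h
    · rw [h]; exact hdiag x
    · exact h.2
  · by_cases hfix : L.formPerm x = x
    · rw [hfix] at hx
      exact hg (by rw [← hx])
    · have hxL : x ∈ L := List.mem_of_formPerm_apply_ne hfix
      have hmem : (x, L.formPerm x) ∈ (L ++ L.take 1).zip (L ++ L.take 1).tail := by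
        rw [zip_tail_cycle_eq_map_formPerm L hLnd hL2]
        exact List.mem_map.2 ⟨x, hxL, rfl⟩
      rw [hzipL, hx, List.mem_cons, List.mem_append, List.mem_singleton] at hmem
      rcases hmem with h | h | h
      · exact hg1 (by rw [h])
      · have harc := rel_of_mem_zip_tail hPchain h
        exact (Finset.mem_erase.1 harc.2).1 rfl
      · exact hg2 (by rw [h])
  · exact List.formPerm_apply_head _ _ _ hLnd
  · rw [← hLlast]; exact List.formPerm_apply_getLast _ _
  · have hc := count_zip_tail_cycle L hLnd hL2 hab
    rw [hzipL, List.count_cons, List.count_append, List.count_singleton] at hc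
    simpa only [beq_iff_eq, List.tail_cons] using hc

/-- Parity bookkeeping for the certificate of (γ). [folklore] -/
private theorem even_of_counts₄ {i₁₁ i₁₂ i₂₁ i₂₂ c₁₁ c₁₂ c₂₁ c₂₂ cT₁ cT₂ δp₁ δp₂ δu₁ δu₂ g₁ g₃ g₄ : ℕ}
    (h₁₁ : c₁₁ + δu₁ + δp₁ = i₁₁) (h₁₂ : c₁₂ + δu₂ + δp₁ = i₁₂) (h₂₁ : c₂₁ + δu₁ + δp₂ = i₂₁)
    (h₂₂ : c₂₂ + δu₂ + δp₂ = i₂₂) (hW₁ : (c₁₁ + cT₁ + c₂₂ + cT₂) % 2 = g₁ % 2)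
    (hW₃ : (cT₁ + c₂₁) % 2 = g₃ % 2) (hW₄ : (cT₂ + c₁₂) % 2 = g₄ % 2) :
    Even (g₁ + g₃ + g₄ + i₂₂ + i₂₁ + i₁₂ + i₁₁) := by
  rw [Nat.even_iff]; omega

/-- **(γ) A removable arc of `D − 0` is contradictory.** In the setting of (β)
(`prod_weights_eq_neg_one`, taken as the hypothesis `hβ`), let `g` be an arc of `D − 0` with
`G.erase g` Pfaffian (normalised Pólya signing `s`, positive on every circuit inside `G.erase g`),
and suppose `D − 0 − g` still has directed paths `Pⱼᵢ` from `pⱼ` to `uᵢ` for all `i, j` and return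
paths `T₁` from `u₁` to `p₂`, `T₂` from `u₂` to `p₁`. Then the four circuits `0 → Pⱼᵢ → 0` together
with the decompositions of the closed walks `P₁₁ T₁ P₂₂ T₂`, `T₁ P₂₁`, `T₂ P₁₂` form an evenly
covering family, positive under `s`, of `t`-weight product `-1`: contradiction
(`prod_weight_eq_prod_sign`). [cite: Little1975, §4] -/
theorem false_of_paths_avoiding (hdiag : ∀ i, (i, i) ∈ G)
    {t : Fin (m + 1) × Fin (m + 1) → ℤˣ} (ht1 : ∀ i, t (i, i) = 1)
    (htpos : ∀ σ : Perm (Fin (m + 1)), σ.IsCycle → (∀ i, (i, σ i) ∈ G) → σ 0 = 0 →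
      Perm.sign σ * ∏ i, t (i, σ i) = 1)
    {g : Fin (m + 1) × Fin (m + 1)} (hg : g.1 ≠ g.2) (hg1 : g.1 ≠ 0) (hg2 : g.2 ≠ 0)
    {s : Fin (m + 1) × Fin (m + 1) → ℤˣ} (hs1 : ∀ i, s (i, i) = 1)
    (hspos : ∀ σ : Perm (Fin (m + 1)), σ.IsCycle → (∀ i, (i, σ i) ∈ G.erase g) →
      Perm.sign σ * ∏ i, s (i, σ i) = 1)
    {p₁ p₂ u₁ u₂ : Fin (m + 1)} (hp₁ : IsArc G 0 p₁) (hp₂ : IsArc G 0 p₂) (hu₁ : IsArc G u₁ 0)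
    (hu₂ : IsArc G u₂ 0) (h11 : p₁ ≠ u₁) (h12 : p₁ ≠ u₂) (h21 : p₂ ≠ u₁) (h22 : p₂ ≠ u₂)
    (hβ : ∀ C₁₁ C₁₂ C₂₁ C₂₂ : Perm (Fin (m + 1)),
      (C₁₁.IsCycle ∧ (∀ x, (x, C₁₁ x) ∈ G) ∧ C₁₁ 0 = p₁ ∧ C₁₁ u₁ = 0) →
      (C₁₂.IsCycle ∧ (∀ x, (x, C₁₂ x) ∈ G) ∧ C₁₂ 0 = p₁ ∧ C₁₂ u₂ = 0) →
      (C₂₁.IsCycle ∧ (∀ x, (x, C₂₁ x) ∈ G) ∧ C₂₁ 0 = p₂ ∧ C₂₁ u₁ = 0) →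
      (C₂₂.IsCycle ∧ (∀ x, (x, C₂₂ x) ∈ G) ∧ C₂₂ 0 = p₂ ∧ C₂₂ u₂ = 0) →
      (Perm.sign C₁₁ * ∏ x, t (x, C₁₁ x)) * (Perm.sign C₁₂ * ∏ x, t (x, C₁₂ x)) *
        (Perm.sign C₂₁ * ∏ x, t (x, C₂₁ x)) * (Perm.sign C₂₂ * ∏ x, t (x, C₂₂ x)) = -1)
    {P₁₁ P₁₂ P₂₁ P₂₂ T₁ T₂ : List (Fin (m + 1))}
    (hP₁₁ : P₁₁.IsChain (IsArc (G.erase g)) ∧ P₁₁.Nodup ∧ (∀ x ∈ P₁₁, x ≠ 0) ∧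
      P₁₁.head? = some p₁ ∧ P₁₁.getLast? = some u₁)
    (hP₁₂ : P₁₂.IsChain (IsArc (G.erase g)) ∧ P₁₂.Nodup ∧ (∀ x ∈ P₁₂, x ≠ 0) ∧
      P₁₂.head? = some p₁ ∧ P₁₂.getLast? = some u₂)
    (hP₂₁ : P₂₁.IsChain (IsArc (G.erase g)) ∧ P₂₁.Nodup ∧ (∀ x ∈ P₂₁, x ≠ 0) ∧
      P₂₁.head? = some p₂ ∧ P₂₁.getLast? = some u₁)
    (hP₂₂ : P₂₂.IsChain (IsArc (G.erase g)) ∧ P₂₂.Nodup ∧ (∀ x ∈ P₂₂, x ≠ 0) ∧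
      P₂₂.head? = some p₂ ∧ P₂₂.getLast? = some u₂)
    (hT₁ : T₁.IsChain (IsArc (G.erase g)) ∧ (∀ x ∈ T₁, x ≠ 0) ∧ T₁.head? = some u₁ ∧
      T₁.getLast? = some p₂)
    (hT₂ : T₂.IsChain (IsArc (G.erase g)) ∧ (∀ x ∈ T₂, x ≠ 0) ∧ T₂.head? = some u₂ ∧
      T₂.getLast? = some p₁) : False := by
  classical
  -- the ports are distinct in the relevant ways (no digon through `0` means `uᵢ ≠ pⱼ`:
  -- here this follows from the paths avoiding the cell ... no: we derive it from the chains)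
  -- the four circuits
  obtain ⟨hc₁₁, hm₁₁, hg₁₁, h0₁₁, hu₁₁, hcount₁₁⟩ := circuit_of_path hdiag hg hg1 hg2 hP₁₁.1 hP₁₁.2.1
    hP₁₁.2.2.1 hP₁₁.2.2.2.1 hP₁₁.2.2.2.2 hp₁ hu₁
  obtain ⟨hc₁₂, hm₁₂, hg₁₂, h0₁₂, hu₁₂, hcount₁₂⟩ := circuit_of_path hdiag hg hg1 hg2 hP₁₂.1 hP₁₂.2.1
    hP₁₂.2.2.1 hP₁₂.2.2.2.1 hP₁₂.2.2.2.2 hp₁ hu₂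
  obtain ⟨hc₂₁, hm₂₁, hg₂₁, h0₂₁, hu₂₁, hcount₂₁⟩ := circuit_of_path hdiag hg hg1 hg2 hP₂₁.1 hP₂₁.2.1
    hP₂₁.2.2.1 hP₂₁.2.2.2.1 hP₂₁.2.2.2.2 hp₂ hu₁
  obtain ⟨hc₂₂, hm₂₂, hg₂₂, h0₂₂, hu₂₂, hcount₂₂⟩ := circuit_of_path hdiag hg hg1 hg2 hP₂₂.1 hP₂₂.2.1
    hP₂₂.2.2.1 hP₂₂.2.2.2.1 hP₂₂.2.2.2.2 hp₂ hu₂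
  set C₁₁ := (0 :: P₁₁).formPerm with hC₁₁
  set C₁₂ := (0 :: P₁₂).formPerm with hC₁₂
  set C₂₁ := (0 :: P₂₁).formPerm with hC₂₁
  set C₂₂ := (0 :: P₂₂).formPerm with hC₂₂
  have hprod := hβ C₁₁ C₁₂ C₂₁ C₂₂ ⟨hc₁₁, hm₁₁, h0₁₁, hu₁₁⟩ ⟨hc₁₂, hm₁₂, h0₁₂, hu₁₂⟩
    ⟨hc₂₁, hm₂₁, h0₂₁, hu₂₁⟩ ⟨hc₂₂, hm₂₂, h0₂₂, hu₂₂⟩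
  -- decomposing a closed walk of `D − 0 − g` into circuits
  have hirr : ∀ x : Fin (m + 1), ¬ IsArc (G.erase g) x x := fun x h => h.1 rfl
  have hdec : ∀ W : List (Fin (m + 1)), 2 ≤ W.length → W.IsChain (IsArc (G.erase g)) →
      W.head? = W.getLast? → (∀ x ∈ W, x ≠ 0) →
      ∃ Γ : List (Perm (Fin (m + 1))), (∀ σ ∈ Γ, σ.IsCycle ∧ (∀ i, (i, σ i) ∈ G.erase g) ∧
          (∀ i, (i, σ i) ∈ G) ∧ σ 0 = 0) ∧
        ∀ a b, a ≠ b → ((W.zip W.tail).count (a, b)) % 2 = (Γ.countP fun σ => σ a = b) % 2 := by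
    intro W hW2 hWc hWcl hW0
    obtain ⟨Γ, hΓ, hcount⟩ := exists_cyclePerms_of_closedWalk hirr W hW2 hWc hWcl
    refine ⟨Γ, fun σ hσ => ?_, hcount⟩
    obtain ⟨hσc, hσrel, hσmem⟩ := hΓ σ hσ
    have hin : ∀ i, (i, σ i) ∈ G.erase g := fun i => by
      rcases hσrel i with h | h
      · rw [h]
        exact Finset.mem_erase.2 ⟨fun h' => hg (by rw [← h']), hdiag i⟩
      · exact h.2
    refine ⟨hσc, hin, fun i => Finset.mem_of_mem_erase (hin i), ?_⟩
    by_contra h0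
    have h12 := List.of_mem_zip (hσmem 0 h0)
    exact hW0 0 h12.1 rfl
  -- unpack the lists
  obtain ⟨hP₁₁c, -, hP₁₁0, hP₁₁h, hP₁₁l⟩ := hP₁₁
  obtain ⟨hP₁₂c, -, hP₁₂0, hP₁₂h, hP₁₂l⟩ := hP₁₂
  obtain ⟨hP₂₁c, -, hP₂₁0, hP₂₁h, hP₂₁l⟩ := hP₂₁
  obtain ⟨hP₂₂c, -, hP₂₂0, hP₂₂h, hP₂₂l⟩ := hP₂₂
  obtain ⟨hT₁c, hT₁0, hT₁h, hT₁l⟩ := hT₁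
  obtain ⟨hT₂c, hT₂0, hT₂h, hT₂l⟩ := hT₂
  -- a list with distinct `head?` and `getLast?` has a non-empty tail; arcs are irreflexive, so
  -- consecutive vertices differ: we decompose `X = x :: X'` with the needed facts
  have hcons : ∀ (X : List (Fin (m + 1))) (x y : Fin (m + 1)), X.IsChain (IsArc (G.erase g)) →
      X.head? = some x → X.getLast? = some y → x ≠ y →
      ∃ X', X = x :: X' ∧ X' ≠ [] ∧ X'.getLast? = some y ∧ X'.IsChain (IsArc (G.erase g)) ∧
        ∀ z ∈ X'.head?, IsArc (G.erase g) x z := by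
    intro X x y hXc hXh hXl hxy
    obtain ⟨x', X', rfl⟩ : ∃ x' X', X = x' :: X' := by
      cases X with
      | nil => simp at hXh
      | cons x' X' => exact ⟨x', X', rfl⟩
    have hx : x' = x := by simpa using hXh
    subst hx
    have hX'ne : X' ≠ [] := by
      rintro rfl
      simp only [List.getLast?_singleton, Option.some_inj] at hXl
      exact hxy hXl
    refine ⟨X', rfl, hX'ne, ?_, hXc.tail, fun z hz => ?_⟩
    · obtain ⟨z, Z, rfl⟩ := List.exists_cons_of_ne_nil hX'ne
      simpa [List.getLast?_cons_cons] using hXl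
    · obtain ⟨z', Z, rfl⟩ := List.exists_cons_of_ne_nil hX'ne
      simp only [List.head?_cons, Option.mem_def, Option.some_inj] at hz
      subst hz
      exact (List.isChain_cons_cons.1 hXc).1
  obtain ⟨T₁', rfl, hT₁'ne, hT₁'l, hT₁'c, hT₁'h⟩ := hcons T₁ u₁ p₂ hT₁c hT₁h hT₁l (Ne.symm h21)
  obtain ⟨T₂', rfl, hT₂'ne, hT₂'l, hT₂'c, hT₂'h⟩ := hcons T₂ u₂ p₁ hT₂c hT₂h hT₂l (Ne.symm h12)
  obtain ⟨P₁₂', rfl, hP₁₂'ne, hP₁₂'l, hP₁₂'c, hP₁₂'h⟩ := hcons P₁₂ p₁ u₂ hP₁₂c hP₁₂h hP₁₂l h12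
  obtain ⟨P₂₁', rfl, hP₂₁'ne, hP₂₁'l, hP₂₁'c, hP₂₁'h⟩ := hcons P₂₁ p₂ u₁ hP₂₁c hP₂₁h hP₂₁l h21
  obtain ⟨P₂₂', rfl, hP₂₂'ne, hP₂₂'l, hP₂₂'c, hP₂₂'h⟩ := hcons P₂₂ p₂ u₂ hP₂₂c hP₂₂h hP₂₂l h22
  have hP₁₁ne : P₁₁ ≠ [] := by rintro rfl; simp at hP₁₁h
  have hP₁₁2 : 2 ≤ P₁₁.length := by
    obtain ⟨P₁₁', hP, hne, -⟩ := hcons P₁₁ p₁ u₁ hP₁₁c hP₁₁h hP₁₁l h11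
    rw [hP, List.length_cons]
    have := List.length_pos_iff.2 hne
    omega
  -- junction helper
  have hjoin : ∀ (A B : List (Fin (m + 1))) (x : Fin (m + 1)), A.getLast? = some x →
      (∀ z ∈ B.head?, IsArc (G.erase g) x z) →
      ∀ x' ∈ A.getLast?, ∀ y ∈ B.head?, IsArc (G.erase g) x' y := by
    intro A B x hA hB x' hx' y hy
    rw [hA, Option.mem_def, Option.some_inj] at hx'
    subst hx'
    exact hB y hy
  -- the walk `W₁ = P₁₁ · T₁ · P₂₂ · T₂`
  set W₁ := P₁₁ ++ T₁' ++ P₂₂' ++ T₂' with hW₁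
  have hA₁l : (P₁₁ ++ T₁').getLast? = some p₂ := by
    rw [List.getLast?_append, hT₁'l]; rfl
  have hA₂l : (P₁₁ ++ T₁' ++ P₂₂').getLast? = some u₂ := by
    rw [List.getLast?_append, hP₂₂'l]; rfl
  have hW₁l : W₁.getLast? = some p₁ := by
    rw [hW₁, List.getLast?_append, hT₂'l]; rfl
  have hW₁h : W₁.head? = some p₁ := by
    rw [hW₁, List.head?_append, List.head?_append, List.head?_append, hP₁₁h]; rfl
  have hW₁c : W₁.IsChain (IsArc (G.erase g)) := by
    rw [hW₁]
    refine List.IsChain.append ?_ hT₂'c (hjoin _ _ u₂ hA₂l hT₂'h)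
    refine List.IsChain.append ?_ hP₂₂'c (hjoin _ _ p₂ hA₁l hP₂₂'h)
    exact List.IsChain.append hP₁₁c hT₁'c (hjoin _ _ u₁ hP₁₁l hT₁'h)
  have hW₁2 : 2 ≤ W₁.length := by
    rw [hW₁, List.length_append, List.length_append, List.length_append]; omega
  have hW₁0 : ∀ x ∈ W₁, x ≠ 0 := by
    intro x hx
    simp only [hW₁, List.mem_append] at hx
    rcases hx with ((hx | hx) | hx) | hx
    · exact hP₁₁0 x hx
    · exact hT₁0 x (List.mem_cons_of_mem _ hx)
    · exact hP₂₂0 x (List.mem_cons_of_mem _ hx)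
    · exact hT₂0 x (List.mem_cons_of_mem _ hx)
  have hW₁count : ∀ q, (W₁.zip W₁.tail).count q = (P₁₁.zip P₁₁.tail).count q +
      ((u₁ :: T₁').zip T₁').count q + ((p₂ :: P₂₂').zip P₂₂').count q +
      ((u₂ :: T₂').zip T₂').count q := by
    intro q
    rw [hW₁, count_zip_tail_append_of_getLast? _ _ u₂ hA₂l,
      count_zip_tail_append_of_getLast? _ _ p₂ hA₁l, count_zip_tail_append_of_getLast? _ _ u₁ hP₁₁l]
  obtain ⟨Γ₁, hΓ₁, hcΓ₁⟩ := hdec W₁ hW₁2 hW₁c (hW₁h.trans hW₁l.symm) hW₁0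
  -- the walk `W₃ = T₁ · P₂₁`
  set W₃ := (u₁ :: T₁') ++ P₂₁' with hW₃
  have hW₃c : W₃.IsChain (IsArc (G.erase g)) :=
    List.IsChain.append hT₁c hP₂₁'c (hjoin _ _ p₂ hT₁l hP₂₁'h)
  have hW₃cl : W₃.head? = W₃.getLast? := by
    rw [hW₃, List.getLast?_append, hP₂₁'l]; rfl
  have hW₃2 : 2 ≤ W₃.length := by
    rw [hW₃, List.length_append, List.length_cons]
    have := List.length_pos_iff.2 hP₂₁'ne; omega
  have hW₃0 : ∀ x ∈ W₃, x ≠ 0 := by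
    intro x hx
    rcases List.mem_append.1 hx with hx | hx
    · exact hT₁0 x hx
    · exact hP₂₁0 x (List.mem_cons_of_mem _ hx)
  have hW₃count : ∀ q, (W₃.zip W₃.tail).count q =
      ((u₁ :: T₁').zip T₁').count q + ((p₂ :: P₂₁').zip P₂₁').count q := fun q => by
    rw [hW₃, count_zip_tail_append_of_getLast? _ _ p₂ hT₁l]; rfl
  obtain ⟨Γ₃, hΓ₃, hcΓ₃⟩ := hdec W₃ hW₃2 hW₃c hW₃cl hW₃0
  -- the walk `W₄ = T₂ · P₁₂`
  set W₄ := (u₂ :: T₂') ++ P₁₂' with hW₄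
  have hW₄c : W₄.IsChain (IsArc (G.erase g)) :=
    List.IsChain.append hT₂c hP₁₂'c (hjoin _ _ p₁ hT₂l hP₁₂'h)
  have hW₄cl : W₄.head? = W₄.getLast? := by
    rw [hW₄, List.getLast?_append, hP₁₂'l]; rfl
  have hW₄2 : 2 ≤ W₄.length := by
    rw [hW₄, List.length_append, List.length_cons]
    have := List.length_pos_iff.2 hP₁₂'ne; omega
  have hW₄0 : ∀ x ∈ W₄, x ≠ 0 := by
    intro x hx
    rcases List.mem_append.1 hx with hx | hx
    · exact hT₂0 x hx
    · exact hP₁₂0 x (List.mem_cons_of_mem _ hx)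
  have hW₄count : ∀ q, (W₄.zip W₄.tail).count q =
      ((u₂ :: T₂').zip T₂').count q + ((p₁ :: P₁₂').zip P₁₂').count q := fun q => by
    rw [hW₄, count_zip_tail_append_of_getLast? _ _ p₁ hT₂l]; rfl
  obtain ⟨Γ₄, hΓ₄, hcΓ₄⟩ := hdec W₄ hW₄2 hW₄c hW₄cl hW₄0
  -- the family
  set F : List (Perm (Fin (m + 1))) := C₁₁ :: C₁₂ :: C₂₁ :: C₂₂ :: (Γ₁ ++ Γ₃ ++ Γ₄) with hF
  have hmemF : ∀ σ ∈ F, σ = C₁₁ ∨ σ = C₁₂ ∨ σ = C₂₁ ∨ σ = C₂₂ ∨ σ ∈ Γ₁ ∨ σ ∈ Γ₃ ∨ σ ∈ Γ₄ := by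
    intro σ hσ
    simpa only [hF, List.mem_cons, List.mem_append, or_assoc] using hσ
  -- even coverage
  have heven : ∀ a b : Fin (m + 1), a ≠ b → Even (F.countP fun σ => σ a = b) := by
    intro a b hab
    have e₁₁ := hcount₁₁ a b hab
    have e₁₂ := hcount₁₂ a b hab
    have e₂₁ := hcount₂₁ a b hab
    have e₂₂ := hcount₂₂ a b hab
    have w₁ := hcΓ₁ a b hab
    rw [hW₁count] at w₁
    have w₃ := hcΓ₃ a b hab
    rw [hW₃count] at w₃
    have w₄ := hcΓ₄ a b hab
    rw [hW₄count] at w₄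
    simp only [List.tail_cons] at e₁₂ e₂₁ e₂₂
    simp only [hF, List.countP_cons, List.countP_append, decide_eq_true_eq]
    exact even_of_counts₄ e₁₁ e₁₂ e₂₁ e₂₂ w₁ w₃ w₄
  -- sign product under `s`: every member lies inside `G.erase g`
  have hCin : ∀ (C : Perm (Fin (m + 1))), (∀ x, (x, C x) ∈ G) → (∀ x, (x, C x) ≠ g) →
      ∀ x, (x, C x) ∈ G.erase g := fun C hm hg' x => Finset.mem_erase.2 ⟨hg' x, hm x⟩
  have hsF : (F.map fun σ => Perm.sign σ * ∏ i, s (i, σ i)).prod = 1 := by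
    apply List.prod_eq_one
    intro x hx
    obtain ⟨σ, hσ, rfl⟩ := List.mem_map.1 hx
    rcases hmemF σ hσ with h | h | h | h | h | h | h
    · rw [h]; exact hspos _ hc₁₁ (hCin _ hm₁₁ hg₁₁)
    · rw [h]; exact hspos _ hc₁₂ (hCin _ hm₁₂ hg₁₂)
    · rw [h]; exact hspos _ hc₂₁ (hCin _ hm₂₁ hg₂₁)
    · rw [h]; exact hspos _ hc₂₂ (hCin _ hm₂₂ hg₂₂)
    · obtain ⟨hc, hin, -, -⟩ := hΓ₁ σ h; exact hspos σ hc hin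
    · obtain ⟨hc, hin, -, -⟩ := hΓ₃ σ h; exact hspos σ hc hin
    · obtain ⟨hc, hin, -, -⟩ := hΓ₄ σ h; exact hspos σ hc hin
  -- sign product under `t`
  have hΓw : ∀ Γ : List (Perm (Fin (m + 1))),
      (∀ σ ∈ Γ, σ.IsCycle ∧ (∀ i, (i, σ i) ∈ G.erase g) ∧ (∀ i, (i, σ i) ∈ G) ∧ σ 0 = 0) →
      (Γ.map fun σ => Perm.sign σ * ∏ i, t (i, σ i)).prod = 1 := by
    intro Γ hΓ
    apply List.prod_eq_one
    intro x hx
    obtain ⟨σ, hσ, rfl⟩ := List.mem_map.1 hx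
    obtain ⟨hc, -, hin, h0⟩ := hΓ σ hσ
    exact htpos σ hc hin h0
  have htF : (F.map fun σ => Perm.sign σ * ∏ i, t (i, σ i)).prod =
      (Perm.sign C₁₁ * ∏ x, t (x, C₁₁ x)) * (Perm.sign C₁₂ * ∏ x, t (x, C₁₂ x)) *
        (Perm.sign C₂₁ * ∏ x, t (x, C₂₁ x)) * (Perm.sign C₂₂ * ∏ x, t (x, C₂₂ x)) := by
    simp only [hF, List.map_cons, List.map_append, List.prod_cons, List.prod_append]
    rw [hΓw Γ₁ hΓ₁, hΓw Γ₃ hΓ₃, hΓw Γ₄ hΓ₄]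
    simp only [mul_one, mul_assoc]
  have h := prod_weight_eq_prod_sign F heven s hs1
  rw [hsF] at h
  have h' := prod_weight_eq_prod_sign F heven t ht1
  rw [htF, ← h, hprod] at h'
  exact absurd h' (by decide)

end Literature.Combinatorics.SimpleGraph
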